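import Mathlib
import Literature.MathematicalPhysics.StatisticalMechanics.Crystallization
import Summits.AtomisticToContinuum.Crystallization.Theorems.BraggSlacknessRigiditySlacknessTransferFourier
import Summits.AtomisticToContinuum.Crystallization.Theorems.BraggSlacknessRigidityHcpDiffractionRigidityDenseCentresAux
import Summits.AtomisticToContinuum.Crystallization.Theorems.BraggSlacknessRigidityHcpDiffractionRigidityDenseCentresAux2

/-!
# The smoothed test function of the quiet-centres stub of `HcpDiffractionRigidity`
# (item `stmt-AtomisticToContinuum-13166`, stub `stub_quietCentres`, Aux file 2)

Fourier-side inputs for the Markov form of the windowed `S3` transfer.  With the Gaussian window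
`G_L(z) = e^{-|z|²/L²}`, its Fourier partner `γ_L(η) = e^{-π²L²|η|²}` (`𝓕γ_L = c_L G_L`,
`c_L = (π/(π²L²))^{3/2}`, `fourier_gam`) and a real test function `h`, the smoothed test function
is `g(ζ) = c_L⁻¹ Re (h ⋆ γ_L)(ζ)` (`= (h ∗ 𝓕⁻¹G_L)(ζ)`; written out in full below, Mathlib's
`MeasureTheory.convolution` with `ContinuousLinearMap.mul ℂ ℂ`).

* `integral_mul_re_pairSum_eq` — **the convolution identity**
  `∫ h(ξ) Re ∑ⱼ∑ₖ G_L(yₖ-yⱼ) e^{2πi⟨ξ,yⱼ⟩} conj e^{2πi⟨ξ,yₖ⟩} dξ = ∫ g(ζ) |∑ⱼ e^{2πi⟨ζ,yⱼ⟩}|² dζ`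
  (Mathlib's `Real.fourier_mul_convolution_eq` and `fourier_gaussian_innerProductSpace`, finite
  sums through the integrals; no Fourier inversion is needed) — registered helper stub
  `stub_quietCentresConvolution`;
* `continuous_smooth`, `abs_smooth_le` — `g` is continuous, and at the points at distance `≥ d/2`
  from `tsupport h ⊆ B(0,R)` it is bounded by `4‖h‖_∞ e^{4πR²} e^{-π²L²d²/8} e^{-π|ζ|²}`
  (`L ≥ 2`, `d ≤ 2R`).

All `[folklore]`.
-/

noncomputable section

namespace Summit.AtomisticToContinuum.Crystallization.Theorems

namespace HcpRigidityQuietCentres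

open MeasureTheory Complex Metric Filter Set
open scoped BigOperators Real RealInnerProductSpace ComplexConjugate FourierTransform Convolution
open Summit.AtomisticToContinuum.Crystallization.Theorems.BraggSlacknessTransfer
open Summit.AtomisticToContinuum.Crystallization.Theorems.HcpRigidityDenseCentres

/-! ## The Fourier-side Gaussian -/

/-- `γ_L` is integrable. [folklore] -/
theorem integrable_gam {L : ℝ} (hL : 0 < L) : Integrable (fun v : EuclideanSpace ℝ (Fin 3) => ((Real.exp (-(Real.pi ^ 2 * L ^ 2) * ‖v‖ ^ 2) : ℝ) : ℂ)) := by
  exact (integrable_rexp_neg_mul_sq_norm (b := Real.pi ^ 2 * L ^ 2) (by positivity)).ofReal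

/-- **`𝓕γ_L = c_L e^{-|·|²/L²}`.** [folklore] -/
theorem fourier_gam {L : ℝ} (hL : 0 < L) (w : EuclideanSpace ℝ (Fin 3)) :
    𝓕 (fun v : EuclideanSpace ℝ (Fin 3) => ((Real.exp (-(Real.pi ^ 2 * L ^ 2) * ‖v‖ ^ 2) : ℝ) : ℂ)) w = (((Real.pi / (Real.pi ^ 2 * L ^ 2)) ^ ((3 : ℝ) / 2) * Real.exp (-(‖w‖ ^ 2) / L ^ 2) : ℝ) : ℂ) := by
  have hB : 0 < Real.pi ^ 2 * L ^ 2 := by positivity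
  have hb : 0 < (((Real.pi ^ 2 * L ^ 2 : ℝ) : ℂ)).re := by rw [Complex.ofReal_re]; exact hB
  have hfun : (fun v : EuclideanSpace ℝ (Fin 3) => ((Real.exp (-(Real.pi ^ 2 * L ^ 2) * ‖v‖ ^ 2) : ℝ) : ℂ)) = fun v : EuclideanSpace ℝ (Fin 3) =>
      cexp (-((Real.pi ^ 2 * L ^ 2 : ℝ) : ℂ) * (‖v‖ : ℂ) ^ 2) := by
    ext v
    rw [Complex.ofReal_exp]
    push_cast
    ring_nf
  rw [hfun, fourier_gaussian_innerProductSpace hb w, gaussConst_eq hB]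
  conv_rhs => rw [Complex.ofReal_mul, Complex.ofReal_exp]
  have hπ : (Real.pi : ℂ) ≠ 0 := by exact_mod_cast Real.pi_pos.ne'
  have hL' : (L : ℂ) ≠ 0 := by exact_mod_cast hL.ne'
  congr 2
  push_cast
  field_simp

/-- The phase pairing is a value of the Fourier transform:
`∫ e^{2πi⟨ξ,u-v⟩} f(ξ) dξ = 𝓕f(v - u)`. [folklore] -/
theorem integral_phase_mul_eq_fourier (f : EuclideanSpace ℝ (Fin 3) → ℂ) (u v : EuclideanSpace ℝ (Fin 3)) :
    ∫ ξ : EuclideanSpace ℝ (Fin 3), cexp (↑(2 * Real.pi * ⟪ξ, u - v⟫) * I) * f ξ = 𝓕 f (v - u) := by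
  rw [Real.fourier_eq']
  refine integral_congr_ae (ae_of_all _ fun ξ => ?_)
  simp only [smul_eq_mul]
  congr 2
  rw [inner_sub_right, inner_sub_right]
  push_cast
  ring

/-- The structure-factor pair sum in phase form:
`∑ⱼ∑ₖ G_jk e^{2πi⟨ξ,yⱼ⟩} conj e^{2πi⟨ξ,yₖ⟩} = ∑ⱼ∑ₖ G_jk e^{2πi⟨ξ,yⱼ-yₖ⟩}`. [folklore] -/
theorem pairSum_eq {N : ℕ} (y : Fin N → EuclideanSpace ℝ (Fin 3)) (L : ℝ) (ξ : EuclideanSpace ℝ (Fin 3)) :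
    ∑ j, ∑ k, (Real.exp (-(‖y k - y j‖ ^ 2) / L ^ 2) : ℂ) *
        cexp (2 * Real.pi * I * (⟪ξ, y j⟫ : ℂ)) * conj (cexp (2 * Real.pi * I * (⟪ξ, y k⟫ : ℂ))) =
      ∑ j, ∑ k, (Real.exp (-(‖y k - y j‖ ^ 2) / L ^ 2) : ℂ) *
        cexp (↑(2 * Real.pi * ⟪ξ, y j - y k⟫) * I) := by
  refine Finset.sum_congr rfl fun j _ => Finset.sum_congr rfl fun k _ => ?_
  rw [phase_sub, mul_assoc]

/-! ## The smoothed test function `g = c_L⁻¹ Re (h ⋆ γ_L)` -/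

/-- The smoothed test function is continuous. [folklore] -/
theorem continuous_smooth (L : ℝ) {h : EuclideanSpace ℝ (Fin 3) → ℝ} (hhc : Continuous h)
    (hhs : HasCompactSupport h) :
    Continuous fun ζ : EuclideanSpace ℝ (Fin 3) => (((Real.pi / (Real.pi ^ 2 * L ^ 2)) ^ ((3 : ℝ) / 2))⁻¹ *
        (((fun t => (h t : ℂ)) ⋆[ContinuousLinearMap.mul ℂ ℂ, volume] (fun v : EuclideanSpace ℝ (Fin 3) => ((Real.exp (-(Real.pi ^ 2 * L ^ 2) * ‖v‖ ^ 2) : ℝ) : ℂ))) ζ).re) := by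
  have hhsC : HasCompactSupport fun t => (h t : ℂ) := hhs.comp_left (g := Complex.ofReal) rfl
  have hgc : Continuous (fun v : EuclideanSpace ℝ (Fin 3) => ((Real.exp (-(Real.pi ^ 2 * L ^ 2) * ‖v‖ ^ 2) : ℝ) : ℂ)) := by fun_prop
  have hconv := hhsC.continuous_convolution_left (ContinuousLinearMap.mul ℂ ℂ) (μ := volume)
    (Complex.continuous_ofReal.comp hhc) hgc.locallyIntegrable
  exact continuous_const.mul (Complex.continuous_re.comp hconv)

/-- The convolution `h ⋆ γ_L` is integrable. [folklore] -/
theorem integrable_conv {L : ℝ} (hL : 0 < L) {h : EuclideanSpace ℝ (Fin 3) → ℝ} (hhc : Continuous h)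
    (hhs : HasCompactSupport h) :
    Integrable ((fun t => (h t : ℂ)) ⋆[ContinuousLinearMap.mul ℂ ℂ, volume] (fun v : EuclideanSpace ℝ (Fin 3) => ((Real.exp (-(Real.pi ^ 2 * L ^ 2) * ‖v‖ ^ 2) : ℝ) : ℂ))) :=
  ((hhc.integrable_of_hasCompactSupport hhs).ofReal).integrable_convolution _ (integrable_gam hL)

/-- `g · |S_N|²` is integrable. [folklore] -/
theorem integrable_smooth_mul_sf {L : ℝ} (hL : 0 < L) {h : EuclideanSpace ℝ (Fin 3) → ℝ} (hhc : Continuous h)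
    (hhs : HasCompactSupport h) {N : ℕ} (y : Fin N → EuclideanSpace ℝ (Fin 3)) :
    Integrable fun ζ : EuclideanSpace ℝ (Fin 3) => (((Real.pi / (Real.pi ^ 2 * L ^ 2)) ^ ((3 : ℝ) / 2))⁻¹ *
        (((fun t => (h t : ℂ)) ⋆[ContinuousLinearMap.mul ℂ ℂ, volume] (fun v : EuclideanSpace ℝ (Fin 3) => ((Real.exp (-(Real.pi ^ 2 * L ^ 2) * ‖v‖ ^ 2) : ℝ) : ℂ))) ζ).re) *
      ‖∑ j, cexp (2 * Real.pi * I * (⟪ζ, y j⟫ : ℂ))‖ ^ 2 := by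
  have h1 : Integrable fun ζ : EuclideanSpace ℝ (Fin 3) => (((Real.pi / (Real.pi ^ 2 * L ^ 2)) ^ ((3 : ℝ) / 2))⁻¹ *
        (((fun t => (h t : ℂ)) ⋆[ContinuousLinearMap.mul ℂ ℂ, volume] (fun v : EuclideanSpace ℝ (Fin 3) => ((Real.exp (-(Real.pi ^ 2 * L ^ 2) * ‖v‖ ^ 2) : ℝ) : ℂ))) ζ).re) :=
    (integrable_conv hL hhc hhs).re.const_mul _
  refine h1.mul_bdd (c := (N : ℝ) ^ 2) (continuous_sf y).aestronglyMeasurable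
    (ae_of_all _ fun ζ => ?_)
  rw [Real.norm_eq_abs, abs_of_nonneg (by positivity)]
  exact sf_le y ζ

/-! ## The convolution identity -/

/-- **The convolution identity.** For a continuous compactly supported real `h`, `L > 0` and a
finite configuration `y`,
`∫ h(ξ) Re ∑ⱼ∑ₖ e^{-|yₖ-yⱼ|²/L²} e^{2πi⟨ξ,yⱼ⟩} conj e^{2πi⟨ξ,yₖ⟩} dξ = ∫ g(ζ) |S_N(ζ)|² dζ`,
`g = c_L⁻¹ Re (h ⋆ γ_L)`. [folklore] -/
theorem integral_mul_re_pairSum_eq {N : ℕ} (y : Fin N → EuclideanSpace ℝ (Fin 3)) {L : ℝ} (hL : 0 < L)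
    {h : EuclideanSpace ℝ (Fin 3) → ℝ} (hhc : Continuous h) (hhs : HasCompactSupport h) :
    ∫ ξ : EuclideanSpace ℝ (Fin 3), h ξ * (∑ j, ∑ k, (Real.exp (-(‖y k - y j‖ ^ 2) / L ^ 2) : ℂ) *
        cexp (2 * Real.pi * I * (⟪ξ, y j⟫ : ℂ)) * conj (cexp (2 * Real.pi * I * (⟪ξ, y k⟫ : ℂ)))).re =
      ∫ ζ : EuclideanSpace ℝ (Fin 3), (((Real.pi / (Real.pi ^ 2 * L ^ 2)) ^ ((3 : ℝ) / 2))⁻¹ *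
        (((fun t => (h t : ℂ)) ⋆[ContinuousLinearMap.mul ℂ ℂ, volume] (fun v : EuclideanSpace ℝ (Fin 3) => ((Real.exp (-(Real.pi ^ 2 * L ^ 2) * ‖v‖ ^ 2) : ℝ) : ℂ))) ζ).re) *
        ‖∑ j, cexp (2 * Real.pi * I * (⟪ζ, y j⟫ : ℂ))‖ ^ 2 := by
  set cL : ℝ := (Real.pi / (Real.pi ^ 2 * L ^ 2)) ^ ((3 : ℝ) / 2) with hcL
  have hcL0 : 0 < cL := by positivity
  set hC : EuclideanSpace ℝ (Fin 3) → ℂ := fun t => (h t : ℂ) with hhC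
  have hhcC : Continuous hC := Complex.continuous_ofReal.comp hhc
  have hhsC : HasCompactSupport hC := hhs.comp_left (g := Complex.ofReal) rfl
  have hCi : Integrable hC := (hhc.integrable_of_hasCompactSupport hhs).ofReal
  set conv : EuclideanSpace ℝ (Fin 3) → ℂ := hC ⋆[ContinuousLinearMap.mul ℂ ℂ, volume] (fun v : EuclideanSpace ℝ (Fin 3) => ((Real.exp (-(Real.pi ^ 2 * L ^ 2) * ‖v‖ ^ 2) : ℝ) : ℂ)) with hconv
  have hconvi : Integrable conv := integrable_conv hL hhc hhs
  set G : Fin N → Fin N → ℝ := fun j k => Real.exp (-(‖y k - y j‖ ^ 2) / L ^ 2) with hG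
  -- phase integrals against an integrable function
  have hphase_int : ∀ {f : EuclideanSpace ℝ (Fin 3) → ℂ}, Integrable f → ∀ j k,
      Integrable fun ξ : EuclideanSpace ℝ (Fin 3) => cexp (↑(2 * Real.pi * ⟪ξ, y j - y k⟫) * I) * f ξ := by
    intro f hf j k
    refine hf.bdd_mul (c := 1) ?_ (ae_of_all _ fun ξ => ?_)
    · exact Continuous.aestronglyMeasurable (by fun_prop)
    · exact (Complex.norm_exp_ofReal_mul_I _).le
  -- left-hand side, complex form
  have hL1 : ∫ ξ : EuclideanSpace ℝ (Fin 3), hC ξ * ∑ j, ∑ k, (G j k : ℂ) *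
      cexp (↑(2 * Real.pi * ⟪ξ, y j - y k⟫) * I) = ∑ j, ∑ k, (G j k : ℂ) * 𝓕 hC (y k - y j) := by
    have hrw : ∀ ξ : EuclideanSpace ℝ (Fin 3), hC ξ * ∑ j, ∑ k, (G j k : ℂ) *
        cexp (↑(2 * Real.pi * ⟪ξ, y j - y k⟫) * I) =
        ∑ j, ∑ k, (G j k : ℂ) * (cexp (↑(2 * Real.pi * ⟪ξ, y j - y k⟫) * I) * hC ξ) := by
      intro ξ
      rw [Finset.mul_sum]
      refine Finset.sum_congr rfl fun j _ => ?_
      rw [Finset.mul_sum]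
      exact Finset.sum_congr rfl fun k _ => by ring
    simp_rw [hrw]
    rw [integral_finsetSum _ fun j _ => integrable_finsetSum _ fun k _ =>
      (hphase_int hCi j k).const_mul _]
    refine Finset.sum_congr rfl fun j _ => ?_
    rw [integral_finsetSum _ fun k _ => (hphase_int hCi j k).const_mul _]
    refine Finset.sum_congr rfl fun k _ => ?_
    rw [integral_const_mul, integral_phase_mul_eq_fourier]
  -- right-hand side, complex form
  have hR1 : ∫ ζ : EuclideanSpace ℝ (Fin 3), conv ζ *
      ((‖∑ j, cexp (2 * Real.pi * I * (⟪ζ, y j⟫ : ℂ))‖ ^ 2 : ℝ) : ℂ) =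
      ∑ j, ∑ k, 𝓕 hC (y k - y j) * ((cL * G j k : ℝ) : ℂ) := by
    have hrw : ∀ ζ : EuclideanSpace ℝ (Fin 3), conv ζ *
        ((‖∑ j, cexp (2 * Real.pi * I * (⟪ζ, y j⟫ : ℂ))‖ ^ 2 : ℝ) : ℂ) =
        ∑ j, ∑ k, cexp (↑(2 * Real.pi * ⟪ζ, y j - y k⟫) * I) * conv ζ := by
      intro ζ
      rw [← sum_sum_phase_sub y ζ, Finset.mul_sum]
      refine Finset.sum_congr rfl fun j _ => ?_
      rw [Finset.mul_sum]
      exact Finset.sum_congr rfl fun k _ => by ring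
    simp_rw [hrw]
    rw [integral_finsetSum _ fun j _ => integrable_finsetSum _ fun k _ => hphase_int hconvi j k]
    refine Finset.sum_congr rfl fun j _ => ?_
    rw [integral_finsetSum _ fun k _ => hphase_int hconvi j k]
    refine Finset.sum_congr rfl fun k _ => ?_
    rw [integral_phase_mul_eq_fourier, hconv,
      Real.fourier_mul_convolution_eq hCi (integrable_gam hL), fourier_gam hL]
  -- compare
  have hLR : ∫ ξ : EuclideanSpace ℝ (Fin 3), hC ξ * ∑ j, ∑ k, (G j k : ℂ) *
      cexp (↑(2 * Real.pi * ⟪ξ, y j - y k⟫) * I) =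
      ((cL)⁻¹ : ℂ) * ∫ ζ : EuclideanSpace ℝ (Fin 3), conv ζ *
        ((‖∑ j, cexp (2 * Real.pi * I * (⟪ζ, y j⟫ : ℂ))‖ ^ 2 : ℝ) : ℂ) := by
    rw [hL1, hR1, Finset.mul_sum]
    refine Finset.sum_congr rfl fun j _ => ?_
    rw [Finset.mul_sum]
    refine Finset.sum_congr rfl fun k _ => ?_
    have hc : (cL : ℂ) ≠ 0 := by exact_mod_cast hcL0.ne'
    push_cast
    field_simp
  -- real parts
  have hintL : Integrable fun ξ : EuclideanSpace ℝ (Fin 3) => hC ξ * ∑ j, ∑ k, (G j k : ℂ) *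
      cexp (↑(2 * Real.pi * ⟪ξ, y j - y k⟫) * I) := by
    refine (hhcC.mul ?_).integrable_of_hasCompactSupport hhsC.mul_right
    fun_prop
  have hintR : Integrable fun ζ : EuclideanSpace ℝ (Fin 3) => conv ζ *
      ((‖∑ j, cexp (2 * Real.pi * I * (⟪ζ, y j⟫ : ℂ))‖ ^ 2 : ℝ) : ℂ) := by
    refine hconvi.mul_bdd (c := (N : ℝ) ^ 2) ?_ (ae_of_all _ fun ζ => ?_)
    · exact (Complex.continuous_ofReal.comp (continuous_sf y)).aestronglyMeasurable
    · rw [Complex.norm_real, Real.norm_eq_abs, abs_of_nonneg (by positivity)]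
      exact sf_le y ζ
  calc ∫ ξ : EuclideanSpace ℝ (Fin 3), h ξ * (∑ j, ∑ k, (Real.exp (-(‖y k - y j‖ ^ 2) / L ^ 2) : ℂ) *
        cexp (2 * Real.pi * I * (⟪ξ, y j⟫ : ℂ)) * conj (cexp (2 * Real.pi * I * (⟪ξ, y k⟫ : ℂ)))).re
      = ∫ ξ : EuclideanSpace ℝ (Fin 3), RCLike.re (hC ξ * ∑ j, ∑ k, (G j k : ℂ) *
          cexp (↑(2 * Real.pi * ⟪ξ, y j - y k⟫) * I)) := by
        refine integral_congr_ae (ae_of_all _ fun ξ => ?_)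
        simp only
        rw [pairSum_eq, RCLike.re_to_complex, hhC, Complex.re_ofReal_mul]
    _ = (∫ ξ : EuclideanSpace ℝ (Fin 3), hC ξ * ∑ j, ∑ k, (G j k : ℂ) *
          cexp (↑(2 * Real.pi * ⟪ξ, y j - y k⟫) * I)).re := by
        rw [integral_re hintL, RCLike.re_to_complex]
    _ = (cL)⁻¹ * (∫ ζ : EuclideanSpace ℝ (Fin 3), conv ζ *
          ((‖∑ j, cexp (2 * Real.pi * I * (⟪ζ, y j⟫ : ℂ))‖ ^ 2 : ℝ) : ℂ)).re := by
        rw [hLR, ← Complex.ofReal_inv, Complex.re_ofReal_mul]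
    _ = (cL)⁻¹ * ∫ ζ : EuclideanSpace ℝ (Fin 3), (conv ζ).re *
          ‖∑ j, cexp (2 * Real.pi * I * (⟪ζ, y j⟫ : ℂ))‖ ^ 2 := by
        rw [← RCLike.re_to_complex, ← integral_re hintR]
        congr 1
        refine integral_congr_ae (ae_of_all _ fun ζ => ?_)
        simp only [RCLike.re_to_complex, Complex.re_mul_ofReal]
    _ = ∫ ζ : EuclideanSpace ℝ (Fin 3), (cL)⁻¹ * (conv ζ).re *
          ‖∑ j, cexp (2 * Real.pi * I * (⟪ζ, y j⟫ : ℂ))‖ ^ 2 := by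
        rw [← integral_const_mul]
        refine integral_congr_ae (ae_of_all _ fun ζ => ?_)
        ring

/-! ## The tail of the smoothed test function -/

/-- The half-width Gaussian has mass `∫ e^{-(π²L²/2)|t - ζ|²} dt = (2π/(π²L²))^{3/2} = 2^{3/2} c_L ≤ 4 c_L`.
[folklore] -/
theorem integral_halfGauss_le {L : ℝ} (hL : 0 < L) (ζ : EuclideanSpace ℝ (Fin 3)) :
    ∫ t : EuclideanSpace ℝ (Fin 3), Real.exp (-(Real.pi ^ 2 * L ^ 2 / 2) * ‖t - ζ‖ ^ 2) ≤ 4 * (Real.pi / (Real.pi ^ 2 * L ^ 2)) ^ ((3 : ℝ) / 2) := by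
  have hB : 0 < Real.pi ^ 2 * L ^ 2 / 2 := by positivity
  rw [integral_sub_right_eq_self
    (fun t : EuclideanSpace ℝ (Fin 3) => Real.exp (-(Real.pi ^ 2 * L ^ 2 / 2) * ‖t‖ ^ 2)) ζ,
    GaussianFourier.integral_rexp_neg_mul_sq_norm hB, finrank_euclideanSpace_fin]
  have h32 : ((3 : ℕ) : ℝ) / 2 = (3 : ℝ) / 2 := by norm_num
  rw [h32]
  have hbase : Real.pi / (Real.pi ^ 2 * L ^ 2 / 2) = 2 * (Real.pi / (Real.pi ^ 2 * L ^ 2)) := by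
    field_simp
  rw [hbase, Real.mul_rpow (by norm_num) (by positivity)]
  have h2 : (2 : ℝ) ^ ((3 : ℝ) / 2) ≤ 4 := by
    calc (2 : ℝ) ^ ((3 : ℝ) / 2) ≤ 2 ^ (2 : ℝ) :=
          Real.rpow_le_rpow_of_exponent_le (by norm_num) (by norm_num)
      _ = 4 := by norm_num
  have hc : 0 ≤ (Real.pi / (Real.pi ^ 2 * L ^ 2)) ^ ((3 : ℝ) / 2) := by positivity
  nlinarith

/-- **Tail bound.** Let `L ≥ 2`, `|h| ≤ M`, `tsupport h ⊆ B(0, R)`, `0 < d ≤ 2R`.  At a point `ζ`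
at distance `≥ d/2` from `tsupport h`,
`|g(ζ)| = |c_L⁻¹ Re (h ⋆ γ_L)(ζ)| ≤ 4 M e^{4πR²} e^{-π²L²d²/8} e^{-π|ζ|²}`. [folklore] -/
theorem abs_smooth_le {L : ℝ} (hL : 2 ≤ L) {h : EuclideanSpace ℝ (Fin 3) → ℝ} {M R d : ℝ}
    (hM : ∀ t, |h t| ≤ M) (hR : tsupport h ⊆ closedBall (0 : EuclideanSpace ℝ (Fin 3)) R) (hd : 0 < d)
    (hdR : d ≤ 2 * R) (ζ : EuclideanSpace ℝ (Fin 3)) (hζ : ∀ t ∈ tsupport h, d / 2 ≤ ‖ζ - t‖) :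
    |(((Real.pi / (Real.pi ^ 2 * L ^ 2)) ^ ((3 : ℝ) / 2))⁻¹ *
        (((fun t => (h t : ℂ)) ⋆[ContinuousLinearMap.mul ℂ ℂ, volume] (fun v : EuclideanSpace ℝ (Fin 3) => ((Real.exp (-(Real.pi ^ 2 * L ^ 2) * ‖v‖ ^ 2) : ℝ) : ℂ))) ζ).re)| ≤
      4 * M * Real.exp (4 * Real.pi * R ^ 2) *
        Real.exp (-(Real.pi ^ 2 * L ^ 2 * d ^ 2 / 8)) * Real.exp (-Real.pi * ‖ζ‖ ^ 2) := by
  have hL0 : 0 < L := by linarith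
  have hM0 : 0 ≤ M := (abs_nonneg _).trans (hM 0)
  have hpi := Real.pi_pos
  have hpi3 := Real.pi_gt_three
  set cL : ℝ := (Real.pi / (Real.pi ^ 2 * L ^ 2)) ^ ((3 : ℝ) / 2) with hcL
  have hc0 : 0 < cL := by positivity
  set τ : ℝ := Real.exp (4 * Real.pi * R ^ 2) * Real.exp (-(Real.pi ^ 2 * L ^ 2 * d ^ 2 / 8)) *
    Real.exp (-Real.pi * ‖ζ‖ ^ 2) with hτ
  have hτ0 : 0 < τ := by positivity
  -- the key exponent inequality, for `t` in the support
  have hkey : ∀ t ∈ tsupport h, Real.exp (-(Real.pi ^ 2 * L ^ 2 / 2) * ‖ζ - t‖ ^ 2) ≤ τ := by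
    intro t ht
    rw [hτ, ← Real.exp_add, ← Real.exp_add, Real.exp_le_exp]
    have htR : ‖t‖ ≤ R := by simpa using hR ht
    have hR0 : 0 ≤ R := (norm_nonneg t).trans htR
    have hdt := hζ t ht
    have hs0 : d ^ 2 / 4 ≤ ‖ζ - t‖ ^ 2 := by nlinarith
    have hππ : Real.pi * 3 ≤ Real.pi ^ 2 := by nlinarith
    have hL4 : 4 ≤ L ^ 2 := by nlinarith
    have hL2 : Real.pi ≤ Real.pi ^ 2 * L ^ 2 / 8 := by
      have := mul_le_mul hππ hL4 (by norm_num) (by positivity)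
      linarith
    have hc0 : (0 : ℝ) ≤ Real.pi ^ 2 * L ^ 2 / 2 := by positivity
    rcases le_or_gt ‖ζ‖ (2 * R) with hsmall | hlarge
    · have hζ2 : ‖ζ‖ ^ 2 ≤ 4 * R ^ 2 := by nlinarith [norm_nonneg ζ]
      have h1 := mul_le_mul_of_nonneg_left hs0 hc0
      have h2 := mul_le_mul_of_nonneg_left hζ2 hpi.le
      nlinarith
    · have h3 : ‖ζ‖ - ‖t‖ ≤ ‖ζ - t‖ := norm_sub_norm_le ζ t
      have h2 : ‖ζ‖ / 2 ≤ ‖ζ - t‖ := by linarith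
      have hs1 : ‖ζ‖ ^ 2 / 4 ≤ ‖ζ - t‖ ^ 2 := by nlinarith [norm_nonneg ζ]
      have hd2 : d ^ 2 ≤ 4 * R ^ 2 := by nlinarith
      have hζ4 : 4 * R ^ 2 ≤ ‖ζ‖ ^ 2 := by nlinarith
      have hnn : 0 ≤ ‖ζ‖ ^ 2 - d ^ 2 := by linarith
      have hA := mul_le_mul_of_nonneg_right hL2 hnn
      have hBB := mul_le_mul_of_nonneg_left hd2 hpi.le
      have h1 := mul_le_mul_of_nonneg_left hs1 hc0
      nlinarith
  -- pointwise bound for the convolution integrand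
  set Φ : EuclideanSpace ℝ (Fin 3) → ℝ := fun t => M * τ * Real.exp (-(Real.pi ^ 2 * L ^ 2 / 2) * ‖t - ζ‖ ^ 2)
    with hΦ
  have hΦi : Integrable Φ := (integrable_rexp_neg_mul_sq_norm_sub (by positivity) ζ).const_mul _
  have hpt : ∀ t : EuclideanSpace ℝ (Fin 3), ‖(h t : ℂ) * (fun v : EuclideanSpace ℝ (Fin 3) => ((Real.exp (-(Real.pi ^ 2 * L ^ 2) * ‖v‖ ^ 2) : ℝ) : ℂ)) (ζ - t)‖ ≤ Φ t := by
    intro t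
    rw [norm_mul, Complex.norm_real, Real.norm_eq_abs, Complex.norm_real, Real.norm_eq_abs,
      abs_of_nonneg (Real.exp_pos _).le]
    by_cases ht : t ∈ tsupport h
    · have hsplit : Real.exp (-(Real.pi ^ 2 * L ^ 2) * ‖ζ - t‖ ^ 2) =
          Real.exp (-(Real.pi ^ 2 * L ^ 2 / 2) * ‖ζ - t‖ ^ 2) *
            Real.exp (-(Real.pi ^ 2 * L ^ 2 / 2) * ‖t - ζ‖ ^ 2) := by
        rw [← Real.exp_add, norm_sub_rev t ζ]; ring_nf
      rw [hsplit, hΦ]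
      have h1 := hkey t ht
      have h2 := hM t
      have h3 := Real.exp_pos (-(Real.pi ^ 2 * L ^ 2 / 2) * ‖t - ζ‖ ^ 2)
      have h4 : |h t| * Real.exp (-(Real.pi ^ 2 * L ^ 2 / 2) * ‖ζ - t‖ ^ 2) ≤ M * τ :=
        mul_le_mul h2 h1 (Real.exp_pos _).le hM0
      calc |h t| * (Real.exp (-(Real.pi ^ 2 * L ^ 2 / 2) * ‖ζ - t‖ ^ 2) *
            Real.exp (-(Real.pi ^ 2 * L ^ 2 / 2) * ‖t - ζ‖ ^ 2))
          = (|h t| * Real.exp (-(Real.pi ^ 2 * L ^ 2 / 2) * ‖ζ - t‖ ^ 2)) *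
            Real.exp (-(Real.pi ^ 2 * L ^ 2 / 2) * ‖t - ζ‖ ^ 2) := by ring
        _ ≤ M * τ * Real.exp (-(Real.pi ^ 2 * L ^ 2 / 2) * ‖t - ζ‖ ^ 2) :=
            mul_le_mul_of_nonneg_right h4 h3.le
    · rw [image_eq_zero_of_notMem_tsupport ht, abs_zero, zero_mul, hΦ]
      positivity
  -- integrate
  have hconv : ((fun t => (h t : ℂ)) ⋆[ContinuousLinearMap.mul ℂ ℂ, volume] (fun v : EuclideanSpace ℝ (Fin 3) => ((Real.exp (-(Real.pi ^ 2 * L ^ 2) * ‖v‖ ^ 2) : ℝ) : ℂ))) ζ =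
      ∫ t : EuclideanSpace ℝ (Fin 3), (h t : ℂ) * (fun v : EuclideanSpace ℝ (Fin 3) => ((Real.exp (-(Real.pi ^ 2 * L ^ 2) * ‖v‖ ^ 2) : ℝ) : ℂ)) (ζ - t) := by
    rw [convolution_def]
    simp only [ContinuousLinearMap.mul_apply']
  have hnorm : ‖((fun t => (h t : ℂ)) ⋆[ContinuousLinearMap.mul ℂ ℂ, volume] (fun v : EuclideanSpace ℝ (Fin 3) => ((Real.exp (-(Real.pi ^ 2 * L ^ 2) * ‖v‖ ^ 2) : ℝ) : ℂ))) ζ‖ ≤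
      M * τ * (4 * cL) := by
    rw [hconv]
    refine (norm_integral_le_of_norm_le hΦi (ae_of_all _ hpt)).trans ?_
    rw [hΦ, integral_const_mul]
    exact mul_le_mul_of_nonneg_left (integral_halfGauss_le hL0 ζ) (by positivity)
  rw [abs_mul, abs_inv, abs_of_pos hc0]
  calc cL⁻¹ * |(((fun t => (h t : ℂ)) ⋆[ContinuousLinearMap.mul ℂ ℂ, volume] (fun v : EuclideanSpace ℝ (Fin 3) => ((Real.exp (-(Real.pi ^ 2 * L ^ 2) * ‖v‖ ^ 2) : ℝ) : ℂ))) ζ).re|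
      ≤ cL⁻¹ * (M * τ * (4 * cL)) := by
        gcongr
        exact (Complex.abs_re_le_norm _).trans hnorm
    _ = 4 * M * Real.exp (4 * Real.pi * R ^ 2) * Real.exp (-(Real.pi ^ 2 * L ^ 2 * d ^ 2 / 8)) *
        Real.exp (-Real.pi * ‖ζ‖ ^ 2) := by
        rw [hτ]; field_simp

end HcpRigidityQuietCentres

/-- **Registered helper stub of `stub_quietCentres` (Aux file 2): the convolution identity.**
For a continuous compactly supported real `h`, `L > 0` and a finite configuration `y` in `ℝ³`,
`∫ h(ξ) Re ∑ⱼ∑ₖ e^{-|yₖ-yⱼ|²/L²} e^{2πi⟨ξ,yⱼ⟩} conj e^{2πi⟨ξ,yₖ⟩} dξ = ∫ c_L⁻¹ Re(h ⋆ γ_L)(ζ) |∑ⱼ e^{2πi⟨ζ,yⱼ⟩}|² dζ`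
with `γ_L(η) = e^{-π²L²|η|²}`, `c_L = (π/(π²L²))^{3/2}`. [folklore] -/
theorem stub_quietCentresConvolution : ∀ (N : ℕ) (y : Fin N → EuclideanSpace ℝ (Fin 3)) (L : ℝ), 0 < L → ∀ h : EuclideanSpace ℝ (Fin 3) → ℝ, Continuous h → HasCompactSupport h → ∫ ξ, h ξ * (∑ j : Fin N, ∑ k : Fin N, (Real.exp (-(‖y k - y j‖ ^ 2) / L ^ 2) : ℂ) * Complex.exp (2 * Real.pi * Complex.I * (inner ℝ ξ (y j) : ℂ)) * (starRingEnd ℂ) (Complex.exp (2 * Real.pi * Complex.I * (inner ℝ ξ (y k) : ℂ)))).re = ∫ ζ, (((Real.pi / (Real.pi ^ 2 * L ^ 2)) ^ ((3 : ℝ) / 2))⁻¹ * (MeasureTheory.convolution (fun t => (h t : ℂ)) (fun v : EuclideanSpace ℝ (Fin 3) => ((Real.exp (-(Real.pi ^ 2 * L ^ 2) * ‖v‖ ^ 2) : ℝ) : ℂ)) (ContinuousLinearMap.mul ℂ ℂ) MeasureTheory.volume ζ).re) * ‖∑ j : Fin N, Complex.exp (2 * Real.pi * Complex.I * (inner ℝ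 ζ (y j) : ℂ))‖ ^ 2 :=
  fun _ y _ hL _ hhc hhs => HcpRigidityQuietCentres.integral_mul_re_pairSum_eq y hL hhc hhs

end Summit.AtomisticToContinuum.Crystallization.Theorems

end
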